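import Literature.Geometry.Lorentzian.CausalFutureProofs
import HarnessLib

/-!
# Concatenation of causal curves with rounded corner AND TAIL CONTROL — brick for the Killing
# PROPAGATION step β' (`stub_killingPropagation'`, K1a) of the line `direct-method-on-the-cone`,
# crux `BondiBartnikRigidity` (stmt-FinalStateConjecture-10807); worker betaA of lead c3

The tree's corner rounding `LorentzianMetric.exists_isFutureCausalCurveOn_trans`
(`Literature/Geometry/Lorentzian/CausalFutureProofs.lean`; O'Neill 1983, Ch. 14, p. 402 with the
corners of everywhere-differentiable causal curves rounded in a chart,
`CausalCurveGluing.corner_rounding_coord`) only returns SOME causal curve from `γ₁ a₁` to `γ₂ b₂`.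
Arguments about the FAITHFUL future domain of dependence `futureDomain` (past-ENDLESS causal
curves, `…DirectMethodDefs.lean`) need to splice a causal segment onto a past-endless causal curve
WITHOUT TOUCHING ITS PAST TAIL.  `exists_isFutureCausalCurveOn_trans_tail` re-runs the tree's
construction (adapted verbatim, with a comment) keeping track of the by-product the original
proof discards: the rounding takes place in a parameter window `(b₁ − ε₀, b₁]` of prescribed size,
and the spliced curve, parametrised so as to EXTEND `γ₁`, coincides with `γ₁` at all parameters
`≤ b₁ − ε₀`.  The registered brick `stub_killingPropagation_causalSplice` is its `Spacetime 4`
instance (signature verbatim).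

Everything is proved; no definitions, no named facts.  References: O'Neill 1983, Ch. 14, p. 402
and Ch. 10, Prop. 10.46 [ONeillSemiRiemannian1983]; Hawking–Ellis 1973, §6.2 [HawkingEllis1973CUP].
-/

-- `maxSynthPendingDepth 3`: instance search on the nested operator space `E →L[ℝ] E →L[ℝ] ℝ`
-- (the model fibre of the bundle of bilinear forms) needs more pending levels than the default.
set_option maxSynthPendingDepth 3
-- D-0017: single-problem summit, `Summit.<S>.<S>.…` by design (cf. lakefile `weak.linter.dupNamespace`).
set_option linter.dupNamespace false

noncomputable section

open Bundle Set Filter Function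
open Literature.Geometry.Lorentzian LorentzianMetric TimeOrientation
open scoped Manifold ContDiff Topology

namespace Summit.FinalStateConjecture.FinalStateConjecture.Theorems.BondiBartnikRigidity.DirectMethod

namespace KillingPropagation

variable {E : Type*} [NormedAddCommGroup E] [NormedSpace ℝ E] {H : Type*} [TopologicalSpace H]
  {I : ModelWithCorners ℝ E H} {n : ℕ∞ω} {M : Type*} [TopologicalSpace M] [ChartedSpace H M]
  [IsManifold I ∞ M] {g : LorentzianMetric I n M} {τ : TimeOrientation g}

-- adapted from `Literature/Geometry/Lorentzian/CausalFutureProofs.lean`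
-- (`LorentzianMetric.exists_isFutureCausalCurveOn_trans`: same construction, with the scale `δ₀`
-- also bounded by the prescribed `ε₀ / 2` and the by-product "the spliced curve IS `γ₁` up to the
-- parameter `b₁ - ε₀`" exported; the spliced curve is re-parametrised so that it extends `γ₁`)
/-- **Concatenation of causal curves with rounded corner and tail control.** On a manifold without
boundary with a `C¹` time-oriented Lorentzian metric, if a future causal curve `γ₁ : [a₁, b₁] → M`
ends where a future causal curve `γ₂ : [a₂, b₂] → M` starts, then for every `ε₀ > 0` some future
causal curve `γ` on `[a₁, b]`, `b₁ < b`… more precisely `b₁ - ε₀ < b`, COINCIDES WITH `γ₁` AT ALL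
PARAMETERS `≤ b₁ - ε₀` and ends at `γ₂ b₂`: the corner is rounded inside the parameter window
`(b₁ - ε₀, b₁]` (O'Neill 1983, Ch. 14, p. 402, transitivity of `≤`, with the corner of
everywhere-differentiable causal curves rounded as in `exists_isFutureCausalCurveOn_trans`).
[cite: ONeillSemiRiemannian1983, Ch. 14, p. 402 and Ch. 10, Prop. 10.46] -/
theorem exists_isFutureCausalCurveOn_trans_tail [BoundarylessManifold I M] (hn : 1 ≤ n)
    {γ₁ γ₂ : ℝ → M} {a₁ b₁ a₂ b₂ : ℝ} (hab₁ : a₁ < b₁) (hab₂ : a₂ < b₂)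
    (hγ₁ : g.IsFutureCausalCurveOn τ γ₁ (Icc a₁ b₁)) (hγ₂ : g.IsFutureCausalCurveOn τ γ₂ (Icc a₂ b₂))
    (hjoin : γ₁ b₁ = γ₂ a₂) {ε₀ : ℝ} (hε₀ : 0 < ε₀) :
    ∃ (γ : ℝ → M) (b : ℝ), b₁ - ε₀ < b ∧ g.IsFutureCausalCurveOn τ γ (Icc a₁ b) ∧
      (∀ t ≤ b₁ - ε₀, γ t = γ₁ t) ∧ γ b = γ₂ b₂ := by
  -- it suffices to construct the curve in the parametrisation with the corner at `0`
  suffices H : ∃ (Γ : ℝ → M) (b : ℝ), -ε₀ < b ∧ g.IsFutureCausalCurveOn τ Γ (Icc (a₁ - b₁) b) ∧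
      (∀ s ≤ -ε₀, Γ s = γ₁ (s + b₁)) ∧ Γ b = γ₂ b₂ by
    obtain ⟨Γ, b, hb, hΓ, htail, hend⟩ := H
    refine ⟨fun t ↦ Γ (t + (-b₁)), b + b₁, by linarith, ?_, fun t ht ↦ ?_, ?_⟩
    · have h := hΓ.comp_add_const (-b₁)
      simp only [sub_neg_eq_add, sub_add_cancel] at h
      exact h
    · show Γ (t + -b₁) = γ₁ t
      rw [htail _ (by linarith), show t + -b₁ + b₁ = t by ring]
    · show Γ (b + b₁ + -b₁) = γ₂ b₂
      rw [show b + b₁ + -b₁ = b by ring, hend]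
  -- the junction point and its chart
  set p : M := γ₁ b₁ with hpdef
  set φ := extChartAt I p with hφ
  set x₀ : E := φ p with hx₀def
  have hps : p ∈ (chartAt H p).source := mem_chart_source H p
  have hx₀t : x₀ ∈ φ.target := (extChartAt I p).map_source (mem_extChartAt_source p)
  have hx₀p : φ.symm x₀ = p := (extChartAt I p).left_inv (mem_extChartAt_source p)
  -- a ball of the model space inside the chart target (no boundary)
  obtain ⟨R, hR, hballR⟩ : ∃ R : ℝ, 0 < R ∧ Metric.ball x₀ R ⊆ φ.target := by
    have hint : x₀ ∈ interior φ.target :=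
      ModelWithCorners.isInteriorPoint_iff.mp (BoundarylessManifold.isInteriorPoint (I := I))
    exact Metric.mem_nhds_iff.mp (mem_interior_iff_mem_nhds.mp hint)
  have hballR' : ∀ x : E, ‖x - x₀‖ < R → x ∈ φ.target :=
    fun x hx ↦ hballR (by rwa [Metric.mem_ball, dist_eq_norm])
  have htn : ∀ x : E, ‖x - x₀‖ < R → φ.target ∈ 𝓝 x := fun x hx ↦
    Filter.mem_of_superset (Metric.isOpen_ball.mem_nhds (by rwa [Metric.mem_ball, dist_eq_norm]))
      hballR
  -- the metric and the time orientation in coordinates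
  set G : E → E →L[ℝ] E →L[ℝ] ℝ := g.coordMetric p with hGdef
  set Tc : E → E := τ.coordTime p with hTcdef
  have hGcd : ContDiffOn ℝ 1 G φ.target := g.contDiffOn_coordMetric hn p
  have hGd : ∀ x, ‖x - x₀‖ < R → DifferentiableAt ℝ G x := fun x hx ↦
    ((hGcd.differentiableOn one_ne_zero) x (hballR' x hx)).differentiableAt (htn x hx)
  have hTc : ∀ x, ‖x - x₀‖ < R → ContinuousAt (fun x ↦ G x (Tc x)) x := fun x hx ↦
    ((hGcd.continuousOn.clm_apply (τ.continuousOn_coordTime hn p)) x (hballR' x hx)).continuousAt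
      (htn x hx)
  have hsymm : ∀ x, ‖x - x₀‖ < R → ∀ v w, G x v w = G x w v :=
    fun x hx v w ↦ g.coordMetric_comm (hballR' x hx) v w
  -- the timecone inequality, transported to coordinates
  have hcone : ∀ x, ‖x - x₀‖ < R → ∀ v w, G x v v ≤ 0 → v ≠ 0 → G x (Tc x) v < 0 →
      G x w w < 0 → G x (Tc x) w < 0 → G x v w < 0 := by
    intro x hx v w hvv hv0 hvf hww hwf
    have hxt := hballR' x hx
    have hw0 : w ≠ 0 := fun h ↦ by rw [h, map_zero] at hwf; exact lt_irrefl 0 hwf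
    have hv : τ.IsFutureDirected _ := (isFutureDirected_symmL_iff (τ := τ) hxt v).mpr ⟨⟨hvv, hv0⟩, hvf⟩
    have hw : τ.IsFutureDirected _ :=
      (isFutureDirected_symmL_iff (τ := τ) hxt w).mpr ⟨⟨hww.le, hw0⟩, hwf⟩
    have hwt : g.IsTimelike _ := (isTimelike_symmL_iff (g := g) hxt w).mpr hww
    have key := hw.val_lt_zero τ hwt hv
    rw [g.symm] at key
    rwa [← g.coordMetric_apply hxt v w] at key
  -- a neighbourhood of the junction which the chart maps into the ball
  set N : Set M := φ.source ∩ φ ⁻¹' Metric.ball x₀ R with hNdef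
  have hN : N ∈ 𝓝 p := Filter.inter_mem (extChartAt_source_mem_nhds p)
    ((continuousAt_extChartAt p).preimage_mem_nhds
      (Metric.isOpen_ball.mem_nhds (Metric.mem_ball_self hR)))
  have hNs : ∀ y ∈ N, y ∈ (chartAt H p).source := fun y hy ↦ by
    rw [← extChartAt_source I p]; exact hy.1
  have hNb : ∀ y ∈ N, ‖φ y - x₀‖ < R := fun y hy ↦ by
    have := hy.2; rwa [mem_preimage, Metric.mem_ball, dist_eq_norm] at this
  -- continuity of `γ₁` at `b₁` and of `γ₂` at `a₂`
  have hc₁b : ContinuousAt γ₁ b₁ := (hγ₁ b₁ ⟨hab₁.le, le_rfl⟩).1.continuousAt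
  have hc₂a : ContinuousAt γ₂ a₂ := (hγ₂ a₂ ⟨le_rfl, hab₂.le⟩).1.continuousAt
  obtain ⟨d₁, hd₁, hd₁N⟩ : ∃ d : ℝ, 0 < d ∧ ∀ t, |t - b₁| < d → γ₁ t ∈ N := by
    have := hc₁b.preimage_mem_nhds hN
    rw [Metric.mem_nhds_iff] at this
    obtain ⟨d, hd, h⟩ := this
    exact ⟨d, hd, fun t ht ↦ h (by rwa [Metric.mem_ball, Real.dist_eq])⟩
  obtain ⟨d₂, hd₂, hd₂N⟩ : ∃ d : ℝ, 0 < d ∧ ∀ t, |t - a₂| < d → γ₂ t ∈ N := by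
    have hN' : N ∈ 𝓝 (γ₂ a₂) := by rwa [← hjoin]
    have := hc₂a.preimage_mem_nhds hN'
    rw [Metric.mem_nhds_iff] at this
    obtain ⟨d, hd, h⟩ := this
    exact ⟨d, hd, fun t ht ↦ h (by rwa [Metric.mem_ball, Real.dist_eq])⟩
  -- the scale `δ₀`
  obtain ⟨δ₀, hδ₀, hδ₀1, hδ₀2, hδ₀3, hδ₀4, hδ₀5⟩ : ∃ δ : ℝ, 0 < δ ∧ 2 * δ ≤ d₁ ∧ 2 * δ ≤ d₂ ∧
      2 * δ ≤ b₁ - a₁ ∧ 2 * δ ≤ b₂ - a₂ ∧ 2 * δ ≤ ε₀ := by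
    set m : ℝ := min (min (min (d₁ / 2) (d₂ / 2)) (min ((b₁ - a₁) / 2) ((b₂ - a₂) / 2))) (ε₀ / 2)
      with hm
    have h1 : m ≤ d₁ / 2 := (min_le_left _ _).trans ((min_le_left _ _).trans (min_le_left _ _))
    have h2 : m ≤ d₂ / 2 := (min_le_left _ _).trans ((min_le_left _ _).trans (min_le_right _ _))
    have h3 : m ≤ (b₁ - a₁) / 2 := (min_le_left _ _).trans ((min_le_right _ _).trans (min_le_left _ _))
    have h4 : m ≤ (b₂ - a₂) / 2 := (min_le_left _ _).trans ((min_le_right _ _).trans (min_le_right _ _))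
    have h5 : m ≤ ε₀ / 2 := min_le_right _ _
    refine ⟨m, ?_, by linarith, by linarith, by linarith, by linarith, by linarith⟩
    simp only [hm, lt_min_iff]
    exact ⟨⟨⟨by positivity, by positivity⟩, by constructor <;> linarith⟩, by positivity⟩
  have hγ₁N : ∀ s, |s| < 2 * δ₀ → γ₁ (s + b₁) ∈ N := fun s hs ↦
    hd₁N _ (by rw [add_sub_cancel_right]; linarith)
  have hγ₂N : ∀ s, |s| < 2 * δ₀ → γ₂ (s + a₂) ∈ N := fun s hs ↦
    hd₂N _ (by rw [add_sub_cancel_right]; linarith)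
  -- the two curves in coordinates, parametrised so that the corner is at `0`
  set c₁ : ℝ → E := fun s ↦ φ (γ₁ (s + b₁)) with hc₁def
  set u₁ : ℝ → E := fun s ↦ (trivializationAt E (TangentSpace I) p).continuousLinearMapAt ℝ
    (γ₁ (s + b₁)) (velocity I γ₁ (s + b₁)) with hu₁def
  set c₂ : ℝ → E := fun s ↦ φ (γ₂ (s + a₂)) with hc₂def
  set u₂ : ℝ → E := fun s ↦ (trivializationAt E (TangentSpace I) p).continuousLinearMapAt ℝ
    (γ₂ (s + a₂)) (velocity I γ₂ (s + a₂)) with hu₂def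
  have hc₁ : ∀ s ∈ Icc (-δ₀) 0, HasDerivAt c₁ (u₁ s) s ∧ ‖c₁ s - x₀‖ < R ∧
      (G (c₁ s) (u₁ s) (u₁ s) ≤ 0 ∧ u₁ s ≠ 0) ∧ G (c₁ s) (Tc (c₁ s)) (u₁ s) < 0 := by
    intro s hs
    have hyN : γ₁ (s + b₁) ∈ N := hγ₁N s (by rw [abs_lt]; constructor <;> linarith [hs.1, hs.2])
    have hy := hNs _ hyN
    obtain ⟨hmd, hfd⟩ := hγ₁ (s + b₁) ⟨by linarith [hs.1], by linarith [hs.2]⟩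
    exact ⟨(hasDerivAt_extChartAt_comp_continuousLinearMapAt (p := p) hmd hy).comp_add_const s b₁, hNb _ hyN,
      (isFutureDirected_iff_coord hy _).mp hfd⟩
  have hc₂ : ∀ s ∈ Icc 0 δ₀, HasDerivAt c₂ (u₂ s) s ∧ ‖c₂ s - x₀‖ < R ∧
      (G (c₂ s) (u₂ s) (u₂ s) ≤ 0 ∧ u₂ s ≠ 0) ∧ G (c₂ s) (Tc (c₂ s)) (u₂ s) < 0 := by
    intro s hs
    have hyN : γ₂ (s + a₂) ∈ N := hγ₂N s (by rw [abs_lt]; constructor <;> linarith [hs.1, hs.2])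
    have hy := hNs _ hyN
    obtain ⟨hmd, hfd⟩ := hγ₂ (s + a₂) ⟨by linarith [hs.1], by linarith [hs.2]⟩
    exact ⟨(hasDerivAt_extChartAt_comp_continuousLinearMapAt (p := p) hmd hy).comp_add_const s a₂, hNb _ hyN,
      (isFutureDirected_iff_coord hy _).mp hfd⟩
  have h₁0 : c₁ 0 = x₀ := by simp [hc₁def, hx₀def, hpdef]
  have h₂0 : c₂ 0 = x₀ := by
    show φ (γ₂ (0 + a₂)) = φ p
    rw [zero_add, ← hjoin]
  -- the velocities at the corner, in coordinates and pulled back to `T_p M`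
  obtain ⟨-, -, ⟨hv₁c, hv₁0⟩, hv₁f⟩ := hc₁ 0 ⟨by linarith, le_rfl⟩
  obtain ⟨-, -, ⟨hv₂c, hv₂0⟩, hv₂f⟩ := hc₂ 0 ⟨le_rfl, hδ₀.le⟩
  rw [h₁0] at hv₁c hv₁f
  rw [h₂0] at hv₂c hv₂f
  set ψ := (trivializationAt E (TangentSpace I) p).symmL ℝ (φ.symm x₀) with hψ
  have hw₁ : τ.IsFutureDirected (ψ (u₁ 0)) :=
    (isFutureDirected_symmL_iff (τ := τ) hx₀t (u₁ 0)).mpr ⟨⟨hv₁c, hv₁0⟩, hv₁f⟩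
  have hw₂ : τ.IsFutureDirected (ψ (u₂ 0)) :=
    (isFutureDirected_symmL_iff (τ := τ) hx₀t (u₂ 0)).mpr ⟨⟨hv₂c, hv₂0⟩, hv₂f⟩
  -- the reparametrised first curve
  have hγ₁' : g.IsFutureCausalCurveOn τ (fun s ↦ γ₁ (s + b₁)) (Icc (a₁ - b₁) 0) := by
    have := hγ₁.comp_add_const b₁; rwa [sub_self] at this
  by_cases hpar : ∃ c : ℝ, 0 < c ∧ u₂ 0 = c • u₁ 0
  · /- **Proportional velocities**: reparametrise `γ₂` affinely so that the two velocities at the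
    junction agree; the concatenation is then differentiable at the junction. -/
    obtain ⟨c, hc, hcu⟩ := hpar
    -- the coordinate curve through the junction
    set ĉ : ℝ → E := CausalCurveGluing.glueAt 0 c₁ (fun s ↦ c₂ (s / c)) with hĉ
    have hĉd : HasDerivAt ĉ (u₁ 0) 0 := by
      refine CausalCurveGluing.hasDerivAt_glueAt (hc₁ 0 ⟨by linarith, le_rfl⟩).1 ?_ ?_
      · have hd₂ : HasDerivAt c₂ (u₂ 0) (0 / c) := by rw [zero_div]; exact (hc₂ 0 ⟨le_rfl, hδ₀.le⟩).1
        have h := hd₂.scomp (0 : ℝ) ((hasDerivAt_id (0 : ℝ)).div_const c)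
        refine h.congr_deriv ?_
        rw [hcu, smul_smul, one_div, inv_mul_cancel₀ hc.ne', one_smul]
      · simp only [zero_div, h₁0, h₂0]
    have hm : g.IsFutureCausalCurveOn τ (φ.symm ∘ ĉ) (Icc 0 0) := by
      refine isFutureCausalCurveOn_extChartAt_symm_comp (U := Metric.ball x₀ R)
        Metric.isOpen_ball hballR (u := fun _ ↦ u₁ 0) fun s hs ↦ ?_
      have hs0 : s = 0 := le_antisymm hs.2 hs.1
      subst hs0
      have hĉ0 : ĉ 0 = x₀ := by rw [hĉ, CausalCurveGluing.glueAt_of_le le_rfl, h₁0]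
      refine ⟨hĉd, ?_, ?_⟩
      · rw [hĉ0]; exact Metric.mem_ball_self hR
      · rw [hĉ0]; exact ⟨⟨hv₁c, hv₁0⟩, hv₁f⟩
    -- the reparametrised second curve
    have hγ₂' : g.IsFutureCausalCurveOn τ (fun s ↦ γ₂ (a₂ + s / c)) (Icc 0 (c * (b₂ - a₂))) := by
      refine hγ₂.comp_affine a₂ hc fun s hs ↦ ⟨?_, ?_⟩
      · have : 0 ≤ s / c := div_nonneg hs.1 hc.le
        linarith
      · have : s / c ≤ b₂ - a₂ := by rw [div_le_iff₀ hc]; linarith [hs.2]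
        linarith
    -- glue
    set δM := min δ₀ (c * δ₀) with hδM
    have hδM0 : 0 < δM := lt_min hδ₀ (mul_pos hc hδ₀)
    have hΓ := IsFutureCausalCurveOn.glue (σ₀ := 0) (σ₁ := 0) le_rfl hδM0 hγ₁' hm hγ₂'
      (fun s hs ↦ by
        have hsN : |s| < 2 * δ₀ := by
          rw [abs_lt]; constructor <;> linarith [hs.1, hs.2, min_le_left δ₀ (c * δ₀)]
        show φ.symm (ĉ s) = γ₁ (s + b₁)
        rw [hĉ, CausalCurveGluing.glueAt_of_le hs.2]
        exact (extChartAt I p).left_inv (hγ₁N s hsN).1)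
      (fun s hs ↦ by
        have hsc : |s / c| < 2 * δ₀ := by
          rw [abs_of_pos (div_pos hs.1 hc), div_lt_iff₀ hc]
          have := min_le_right δ₀ (c * δ₀)
          nlinarith [hs.2, this, hδ₀, hc]
        show φ.symm (ĉ s) = γ₂ (a₂ + s / c)
        rw [hĉ, CausalCurveGluing.glueAt_of_lt hs.1, add_comm a₂]
        exact (extChartAt I p).left_inv (hγ₂N (s / c) hsc).1)
    have hpos : 0 < c * (b₂ - a₂) := mul_pos hc (sub_pos.mpr hab₂)
    refine ⟨_, c * (b₂ - a₂), by linarith, hΓ, fun s hs ↦ ?_, ?_⟩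
    · rw [CausalCurveGluing.glueAt_of_le (by linarith)]
    · rw [CausalCurveGluing.glueAt_of_lt hpos, CausalCurveGluing.glueAt_of_lt hpos]
      show γ₂ (a₂ + c * (b₂ - a₂) / c) = γ₂ b₂
      congr 1; field_simp; ring
  · /- **Non-proportional velocities**: their sum is future timelike; round the corner in the
    chart. -/
    have hne : ¬ ∃ c : ℝ, 0 < c ∧ ψ (u₂ 0) = c • ψ (u₁ 0) := by
      rintro ⟨c, hc, hcψ⟩
      refine hpar ⟨c, hc, ?_⟩
      have hb : φ.symm x₀ ∈ (trivializationAt E (TangentSpace I) p).baseSet := by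
        rw [hx₀p]; simp
      have h1 := congrArg ((trivializationAt E (TangentSpace I) p).continuousLinearMapAt ℝ
        (φ.symm x₀)) hcψ
      rwa [map_smul, hψ, Trivialization.continuousLinearMapAt_symmL _ hb,
        Trivialization.continuousLinearMapAt_symmL _ hb] at h1
    have hDt : g.IsTimelike (ψ (u₁ 0) + ψ (u₂ 0)) := hw₁.isTimelike_add hw₂ hne
    have hDf : τ.IsFutureDirected (ψ (u₁ 0) + ψ (u₂ 0)) := hw₁.add τ hw₂
    rw [← map_add] at hDt hDf
    have hD : G x₀ (u₁ 0 + u₂ 0) (u₁ 0 + u₂ 0) < 0 := (isTimelike_symmL_iff (g := g) hx₀t _).mp hDt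
    have hTD : G x₀ (Tc x₀) (u₁ 0 + u₂ 0) < 0 :=
      ((isFutureDirected_symmL_iff (τ := τ) hx₀t _).mp hDf).2
    -- round the corner in coordinates
    obtain ⟨ε, s₄, hε0, -, hεδ₀, hεs₄, ĉ, û, hgood, hleftc, hrightc⟩ :=
      CausalCurveGluing.corner_rounding_coord (ε₁ := δ₀) hR hδ₀ hδ₀ hGd hTc hsymm hcone hc₁ hc₂
        h₁0 h₂0 hD hTD
    -- the middle piece is a causal curve
    have hm : g.IsFutureCausalCurveOn τ (φ.symm ∘ ĉ) (Icc (-ε) s₄) :=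
      isFutureCausalCurveOn_extChartAt_symm_comp (U := Metric.ball x₀ R) Metric.isOpen_ball hballR
        fun s hs ↦ by
          obtain ⟨hd, hb, hcs⟩ := hgood s hs
          exact ⟨hd, by rwa [Metric.mem_ball, dist_eq_norm], hcs⟩
    -- the reparametrised second curve
    have hγ₂' : g.IsFutureCausalCurveOn τ (fun s ↦ γ₂ (s + (a₂ + ε - s₄)))
        (Icc s₄ (s₄ + (b₂ - a₂ - ε))) := by
      refine (hγ₂.comp_add_const (a₂ + ε - s₄)).mono (Icc_subset_Icc (by linarith) (by linarith))
    -- glue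
    have hΓ := IsFutureCausalCurveOn.glue (σ₀ := -ε) (σ₁ := s₄) hεs₄.le hδ₀
      (hγ₁'.mono (Icc_subset_Icc le_rfl (by linarith))) hm hγ₂'
      (fun s hs ↦ by
        have hsN : |s| < 2 * δ₀ := by rw [abs_lt]; constructor <;> linarith [hs.1, hs.2]
        show φ.symm (ĉ s) = γ₁ (s + b₁)
        rw [hleftc s hs.2]
        exact (extChartAt I p).left_inv (hγ₁N s hsN).1)
      (fun s hs ↦ by
        have hsN : |s - s₄ + ε| < 2 * δ₀ := by
          rw [abs_lt]; constructor <;> linarith [hs.1, hs.2]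
        show φ.symm (ĉ s) = γ₂ (s + (a₂ + ε - s₄))
        rw [hrightc s hs.1.le, show s + (a₂ + ε - s₄) = (s - s₄ + ε) + a₂ by ring]
        exact (extChartAt I p).left_inv (hγ₂N _ hsN).1)
    refine ⟨_, s₄ + (b₂ - a₂ - ε), by linarith, hΓ, fun s hs ↦ ?_, ?_⟩
    · rw [CausalCurveGluing.glueAt_of_le (by linarith)]
    · rw [CausalCurveGluing.glueAt_of_lt (by linarith), CausalCurveGluing.glueAt_of_lt (by linarith)]
      show γ₂ (s₄ + (b₂ - a₂ - ε) + (a₂ + ε - s₄)) = γ₂ b₂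
      congr 1; ring

end KillingPropagation

open KillingPropagation in
/-- **Registered brick `stub_killingPropagation_causalSplice` of `stub_killingPropagation'`
(K1a β')**: concatenation of causal curves of a `Spacetime 4` with rounded corner and tail control
(instance of `exists_isFutureCausalCurveOn_trans_tail`).
[cite: ONeillSemiRiemannian1983, Ch. 14, p. 402 and Ch. 10, Prop. 10.46] -/
theorem stub_killingPropagation_causalSplice : ∀ (𝒮 : Spacetime.{0} 4) (γ₁ γ₂ : ℝ → 𝒮.carrier) (a₁ b₁ a₂ b₂ ε₀ : ℝ), a₁ < b₁ → a₂ < b₂ → 𝒮.metric.IsFutureCausalCurveOn 𝒮.timeOrientation γ₁ (Icc a₁ b₁) → 𝒮.metric.IsFutureCausalCurveOn 𝒮.timeOrientation γ₂ (Icc a₂ b₂) → γ₁ b₁ = γ₂ a₂ → 0 < ε₀ → ∃ (γ : ℝ → 𝒮.carrier) (b : ℝ), b₁ - ε₀ < b ∧ 𝒮.metric.IsFutureCausalCurveOn 𝒮.timeOrientation γ (Icc a₁ b) ∧ (∀ t ≤ b₁ - ε₀, γ t = γ₁ t) ∧ γ b = γ₂ b₂ :=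
  fun _ _ _ _ _ _ _ _ hab₁ hab₂ hγ₁ hγ₂ hjoin hε₀ ↦
    exists_isFutureCausalCurveOn_trans_tail (le_trans one_le_two (WithTop.coe_le_coe.mpr le_top))
      hab₁ hab₂ hγ₁ hγ₂ hjoin hε₀

end Summit.FinalStateConjecture.FinalStateConjecture.Theorems.BondiBartnikRigidity.DirectMethod

end
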